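import Literature.MathematicalPhysics.QuantumLattice.Phi4BoxGaussianBounds
import Literature.Probability.LatticeModels.AizenmanWickBoundCouplings
import Literature.Probability.LatticeModels.AizenmanWickBoundProofs
import Literature.Probability.LatticeModels.CorrelationInequalitiesProofs
import HarnessLib

/-!
# Aizenman's Wick-deviation bound (Prop. 12.1) for lattice `φ⁴` measures, via the block Ising approximation

Proofs-only file (topic `Literature/MathematicalPhysics/QuantumLattice`; **theorems only, no
definition, no named fact**). Fourth step of the `φ⁴` line of Aizenman–Duminil-Copin 2021 in the
tree's vocabulary, after `GriffithsSimonApproximation.lean` (block-Ising approximants of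
`phi4Measure`), `Phi4NewmanGaussianInequality.lean` (the LOWER half `S_{2n} ≤ 𝒢_n[S₂]` of ADC (6.3)
and Newman's domination) and `Phi4BoxGaussianBounds.lean` (transport to the free-boundary volumes of
`ℤᵈ`): here the UPPER half of the Wick sandwich — in the source form of Aizenman, Comm. Math. Phys. 86
(1982), Prop. 12.1, eq. (12.3), `|S_{2n} - G_{2n}| ≤ (3/2) R_{2n}`,
`R_{2n} = ∑_{4-subsets} |U₄| G_{2n-4}` ("in a `φ⁴` field theory described by (9.4), or a
ferromagnetic Ising system"; the tree's `wickRemainder`, `pairingSum`) — is moved from the Ising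
theorem of the tree (`aizenman_wickDeviation_le_finite_holds`, `AizenmanWickBoundProofs`; general
pair couplings: `PairIsing.wickDeviation_le`, `AizenmanWickBoundCouplings`) to the lattice `φ⁴`
measures, exactly as Aizenman–Duminil-Copin indicate (§7, p. 28: "we identify `⟨·⟩_{ρ,β}` with the
Ising measure, and `τₓ` with the proper average of Ising's variables … the basic diagrammatic bounds
which are available for the Ising model extend to the GS class essentially by linearity, and then to
the GS class by continuity").

## Contents (all proved)

* Part 1. `PairIsing.ursellFour_nonpos` — Lebowitz' inequality `U₄ ≤ 0` for arbitrary nonnegative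
  pair couplings on a finite set (from `lebowitz_holds` on the decorated graphs,
  `PairIsing.connectedFour_decorGraph_inl`, `PairIsing.exists_decor_approx`).
* Part 2 (block variables `τₓ = ∑_l w_l σ_{(x,l)}`, `w ≥ 0`, on `V × β`). `pairIdx_two_vals`,
  `sum_prod_mul_pair_pair_eq` (a product of two block two-point functions as one smeared sum over
  `β⁴`, from `sum_prod_mul_prod_pairs_eq`), `PairIsing.avg_prod_blockVar_eq_sum` (block `m`-point
  functions are smeared spin correlations), **`PairIsing.block_ursell_eq_sum`** (the block `U₄` is the
  smeared spin `U₄`), `PairIsing.abs_sum_prod_mul_ursellFour` (`|∑ (∏w) U₄| = ∑ (∏w) |U₄|` by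
  Lebowitz' sign) and **`PairIsing.block_wickDeviation_le`**: Prop. 12.1 for the block variables —
  the `2n`-point function and the pairing functional are multilinear (`sum_prod_mul_pairingSum_eq` of
  `Phi4NewmanGaussianInequality`), the remainder factorises along each `4`-subset
  (`sum_prod_mul_removeFour_mul_restrictFour`), and the smeared `|U₄|`-factor is `|U₄^τ|`.
* Part 3. `blockIsing_wickDeviation_le` (the block Ising lattice laws
  `latticeFieldMeasure G (isingMagnetizationLaw N K w) J`, through
  `integral_latticeFieldMeasure_isingMagnetizationLaw_eq_avg`) and **`phi4_wickDeviation_le`**: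
  Prop. 12.1 for `phi4Measure G g κ J` (`g > 0`, `J ≥ 0`) on any finite graph, by
  `exists_blockIsing_tendsto_integral_phi4Measure` and continuity (`tendsto_pairingSum`,
  `tendsto_wickRemainder`).
* Part 4. `nPoint_phi4FreeMeasure_eq_of_mem`, **`phi4Free_wickDeviation_le`** (free-boundary volumes
  `Λ ⊂ ℤᵈ`, points in `Λ`: `phi4TwoPointIn`, `connectedFour (phi4FreeMeasure d Λ g κ J)`) and
  **`phi4Box_wickDeviation_le`** — literally the hypothesis `hW` of
  `Literature.MathematicalPhysics.QuantumFieldTheory.phi44_triviality_of_wickDeviation`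
  (`QuantumFieldTheory/ContinuumLimitsPhi4WickProofs.lean`).

## Sources

* M. Aizenman, *Geometric analysis of `φ⁴` fields and Ising models I, II*, Comm. Math. Phys. 86
  (1982) 1–48, Prop. 12.1, eq. (12.3) (p. 37); Prop. 5.3 (Lebowitz). [AizenmanCMP1982]
* M. Aizenman, H. Duminil-Copin, Ann. Math. 194 (2021) = arXiv:1912.07973, §6.3 (6.3) (p. 26), §7
  (p. 28). [AizenmanDuminilCopinAnnals2021]
* J. Glimm, A. Jaffe, *Quantum Physics* (2nd ed. 1987), Cor. 4.3.3 (Lebowitz' inequality).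
  [GlimmJaffe1987]

## Tree anchors

`PairIsing.wickDeviation_le`, `PairIsing.ursellFour(_def,_offDiag)`, `PairIsing.continuous_ursellFour`,
`PairIsing.connectedFour_decorGraph_inl`, `PairIsing.exists_decor_approx` (`AizenmanWickBoundCouplings`);
`aizenman_wickDeviation_le_finite_holds` (`AizenmanWickBoundProofs`); `lebowitz_holds`
(`CorrelationInequalitiesProofs`); `wickRemainder`, `removeFour₂`, `two_mul_sub_two`,
`sum_piFinset_prod_mul_comp_cast`, `wickRemainder_congr_of_eq`, `tendsto_wickRemainder`
(`AizenmanWickBound`); `pairingSum`, `pairIdx(_apply_val)`, `restrictFour`, `removeFour`,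
`sum_prod_mul_removeFour_mul_restrictFour`, `tendsto_pairingSum` (`HighDimTrivialityWick`);
`pairingSum_congr_of_eq` (`GaussianPairingBound`); `PairIsing.avg(_finset_sum,_const_mul)`
(`GaussianPairingBoundCouplings`); `sum_prod_mul_prod_pairs_eq`, `sum_prod_mul_pairingSum_eq`,
`integral_latticeFieldMeasure_isingMagnetizationLaw_eq_avg`, `blockCoupling_nonneg`, `abs_prod_apply_le`
(`Phi4NewmanGaussianInequality`); `exists_blockIsing_tendsto_integral_phi4Measure`
(`GriffithsSimonApproximation`); `integral_phi4FreeMeasure` (`Phi4BoxGaussianBounds`);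
`phi4TwoPointIn_eq_of_mem` (`LatticeScalarFieldGriffithsProofs`). Mathlib: `Fintype.prod_sum`,
`Fintype.piFinset_univ`, `Equiv.swap`, `le_of_tendsto'`, `le_of_tendsto_of_tendsto'`.
-/

noncomputable section

open MeasureTheory Filter Topology Finset

namespace Literature.MathematicalPhysics.QuantumLattice

open Literature.Probability.LatticeModels

/-! ### Part 1. Lebowitz' inequality for pair-interaction Ising models -/

section PairLebowitz

variable {ι : Type*} [Fintype ι] [DecidableEq ι]

/-- **Lebowitz' inequality `U₄ ≤ 0` for general ferromagnetic pair couplings on a finite set**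
(Lebowitz 1974; Glimm–Jaffe 1987, Cor. 4.3.3), from the tree's unit-coupling graph theorem
`lebowitz_holds` through the decoration transformation of `GaussianPairingBoundCouplings`
(`connectedFour_decorGraph_inl`, `PairIsing.exists_decor_approx`, continuity in the couplings).
[cite: GlimmJaffe1987, Cor. 4.3.3] -/
theorem PairIsing.ursellFour_nonpos (c : ι → ι → ℝ) (hc : ∀ a b, a ≠ b → 0 ≤ c a b)
    (u : Fin 4 → ι) : PairIsing.ursellFour c u ≤ 0 := by
  classical
  obtain ⟨β₀, k, hβ₀, hk, hconv⟩ := PairIsing.exists_decor_approx c hc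
  have hineq : ∀ m, PairIsing.ursellFour (fun a b => PairIsing.decorK (β₀ m) * (k m a b : ℝ)) u ≤ 0 :=
    fun m => by
      rw [← PairIsing.connectedFour_decorGraph_inl (hk m) (β₀ m) u]
      exact lebowitz_holds (PairIsing.decorGraph (k m)) (hβ₀ m) Finset.univ (Sum.inl ∘ u)
        fun i => Finset.mem_univ _
  have hl : Tendsto (fun m => PairIsing.ursellFour (fun a b => PairIsing.decorK (β₀ m) * (k m a b : ℝ)) u)
      atTop (𝓝 (PairIsing.ursellFour (PairIsing.offDiag c) u)) :=
    ((PairIsing.continuous_ursellFour u).tendsto _).comp hconv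
  have hlim := le_of_tendsto' hl hineq
  rwa [PairIsing.ursellFour_offDiag] at hlim

end PairLebowitz

/-! ### Part 2. Block variables: smearing the pair-interaction statements over the constituents -/

section Blocks

variable {V : Type} {β : Type} [Fintype β]

/-- `pairIdx 2` enumerates `Fin 4` as `(0,0) ↦ 0`, `(0,1) ↦ 1`, `(1,0) ↦ 2`, `(1,1) ↦ 3`. [folklore] -/
theorem pairIdx_two_vals :
    (pairIdx 2 (0, 0) : Fin (2 * 2)) = 0 ∧ (pairIdx 2 (0, 1) : Fin (2 * 2)) = 1 ∧
      (pairIdx 2 (1, 0) : Fin (2 * 2)) = 2 ∧ (pairIdx 2 (1, 1) : Fin (2 * 2)) = 3 := by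
  refine ⟨?_, ?_, ?_, ?_⟩ <;> exact Fin.ext (by rw [pairIdx_apply_val]; rfl)

/-- **A product of two smeared two-point functions as one smeared sum over `β⁴`**: for any
`T : (V×β) → (V×β) → ℝ`, weights `w` and an ordering `τ` of `Fin 4`,
`∑_{L : Fin 4 → β} (∏ w_{L_m}) T((u_{τ0},L_{τ0}),(u_{τ1},L_{τ1})) T((u_{τ2},L_{τ2}),(u_{τ3},L_{τ3}))
 = T^w(u_{τ0},u_{τ1}) T^w(u_{τ2},u_{τ3})`, `T^w(a,a') = ∑_{l,l'} w_l w_{l'} T((a,l),(a',l'))`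
(`sum_prod_mul_prod_pairs_eq` with `n = 2`). [folklore] -/
theorem sum_prod_mul_pair_pair_eq (T : V × β → V × β → ℝ) (w : β → ℝ) (u : Fin 4 → V)
    (τ : Equiv.Perm (Fin (2 * 2))) :
    ∑ L : Fin (2 * 2) → β, (∏ i, w (L i)) *
        (T (u (τ 0), L (τ 0)) (u (τ 1), L (τ 1)) * T (u (τ 2), L (τ 2)) (u (τ 3), L (τ 3))) =
      (∑ l, ∑ l', w l * w l' * T (u (τ 0), l) (u (τ 1), l')) *
        ∑ l, ∑ l', w l * w l' * T (u (τ 2), l) (u (τ 3), l') := by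
  obtain ⟨h00, h01, h10, h11⟩ := pairIdx_two_vals
  have key := sum_prod_mul_prod_pairs_eq w
    (fun j l l' => T (u (τ (pairIdx 2 (j, 0))), l) (u (τ (pairIdx 2 (j, 1))), l')) τ
  simp only [Fin.prod_univ_two, h00, h01, h10, h11] at key
  simpa only [Fin.isValue] using key

variable [Fintype V] [DecidableEq V] [DecidableEq β]

/-- **Block `m`-point functions as smeared spin correlations**: for block variables
`τₓ = ∑_l w_l σ_{(x,l)}`, `⟨∏ᵢ τ_{xᵢ}⟩_c = ∑_L (∏ᵢ w_{Lᵢ}) ⟨∏ᵢ σ_{(xᵢ,Lᵢ)}⟩_c` (multilinearity).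
[cite: AizenmanDuminilCopinAnnals2021, §7 (p. 28, "by linearity")] -/
theorem PairIsing.avg_prod_blockVar_eq_sum (c : V × β → V × β → ℝ) (w : β → ℝ) {m : ℕ}
    (x : Fin m → V) :
    PairIsing.avg c (fun ρ => ∏ i, ∑ l, w l * (spinAt (x i, l) ρ : ℝ)) =
      ∑ L : Fin m → β, (∏ i, w (L i)) * PairIsing.avg c (spinMonomial fun i => (x i, L i)) := by
  have hprod : ∀ ρ : SpinConfig (V × β), ∏ i, ∑ l, w l * (spinAt (x i, l) ρ : ℝ) =
      ∑ L : Fin m → β, (∏ i, w (L i)) * spinMonomial (fun i => (x i, L i)) ρ := fun ρ => by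
    rw [Fintype.prod_sum]
    refine Finset.sum_congr rfl fun L _ => ?_
    rw [spinMonomial, ← Finset.prod_mul_distrib]
  simp_rw [hprod]
  rw [PairIsing.avg_finset_sum]
  exact Finset.sum_congr rfl fun L _ => PairIsing.avg_const_mul c _ _

/-- **The block four-point Ursell function is the smeared spin Ursell function**:
`U₄^τ(u) = ∑_{L : Fin 4 → β} (∏ w_{L_m}) U₄^c((u₀,L₀),…,(u₃,L₃))`, where
`U₄^τ(u) = ⟨τ_{u₀}τ_{u₁}τ_{u₂}τ_{u₃}⟩ - S^τS^τ - S^τS^τ - S^τS^τ` with the block two-point function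
`S^τ(a,a') = ∑_{l,l'} w_l w_{l'} ⟨σ_{(a,l)}σ_{(a',l')}⟩_c` (multilinearity of each term;
`sum_prod_mul_pair_pair_eq` for the three products of two-point functions). [cite: AizenmanDuminilCopinAnnals2021, §7 (p. 28, "by linearity")] -/
theorem PairIsing.block_ursell_eq_sum (c : V × β → V × β → ℝ) (w : β → ℝ) (u : Fin 4 → V) :
    PairIsing.avg c (fun ρ => ∏ m, ∑ l, w l * (spinAt (u m, l) ρ : ℝ)) -
        (∑ l, ∑ l', w l * w l' * PairIsing.avg c (spinPair (u 0, l) (u 1, l'))) *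
          (∑ l, ∑ l', w l * w l' * PairIsing.avg c (spinPair (u 2, l) (u 3, l'))) -
        (∑ l, ∑ l', w l * w l' * PairIsing.avg c (spinPair (u 0, l) (u 2, l'))) *
          (∑ l, ∑ l', w l * w l' * PairIsing.avg c (spinPair (u 1, l) (u 3, l'))) -
        (∑ l, ∑ l', w l * w l' * PairIsing.avg c (spinPair (u 0, l) (u 3, l'))) *
          (∑ l, ∑ l', w l * w l' * PairIsing.avg c (spinPair (u 1, l) (u 2, l'))) =
      ∑ L : Fin (2 * 2) → β, (∏ m, w (L m)) * PairIsing.ursellFour c (fun m => (u m, L m)) := by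
  set T : V × β → V × β → ℝ := fun p q => PairIsing.avg c (spinPair p q) with hT
  -- the three pairings as orderings of `Fin 4`
  have h1 := sum_prod_mul_pair_pair_eq T w u 1
  have h2 := sum_prod_mul_pair_pair_eq T w u (Equiv.swap 1 2)
  have h3 := sum_prod_mul_pair_pair_eq T w u (Equiv.swap 2 3 * Equiv.swap 1 2)
  have e21 : (Equiv.swap (1 : Fin (2 * 2)) 2) 0 = 0 := by decide
  have e22 : (Equiv.swap (1 : Fin (2 * 2)) 2) 1 = 2 := by decide
  have e23 : (Equiv.swap (1 : Fin (2 * 2)) 2) 2 = 1 := by decide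
  have e24 : (Equiv.swap (1 : Fin (2 * 2)) 2) 3 = 3 := by decide
  have e31 : ((Equiv.swap (2 : Fin (2 * 2)) 3 * Equiv.swap 1 2 : Equiv.Perm (Fin (2 * 2))) : Fin (2 * 2) → Fin (2 * 2)) 0 = 0 := by decide
  have e32 : ((Equiv.swap (2 : Fin (2 * 2)) 3 * Equiv.swap 1 2 : Equiv.Perm (Fin (2 * 2))) : Fin (2 * 2) → Fin (2 * 2)) 1 = 3 := by decide
  have e33 : ((Equiv.swap (2 : Fin (2 * 2)) 3 * Equiv.swap 1 2 : Equiv.Perm (Fin (2 * 2))) : Fin (2 * 2) → Fin (2 * 2)) 2 = 1 := by decide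
  have e34 : ((Equiv.swap (2 : Fin (2 * 2)) 3 * Equiv.swap 1 2 : Equiv.Perm (Fin (2 * 2))) : Fin (2 * 2) → Fin (2 * 2)) 3 = 2 := by decide
  simp only [Equiv.Perm.coe_one, id_eq] at h1
  rw [e21, e22, e23, e24] at h2
  rw [e31, e32, e33, e34] at h3
  -- the four-point term
  have h0 := PairIsing.avg_prod_blockVar_eq_sum c w u
  -- assemble
  have hU : ∀ L : Fin (2 * 2) → β, (∏ m, w (L m)) * PairIsing.ursellFour c (fun m => (u m, L m)) =
      (∏ m, w (L m)) * PairIsing.avg c (spinMonomial fun m => (u m, L m)) -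
        (∏ m, w (L m)) * (T (u 0, L 0) (u 1, L 1) * T (u 2, L 2) (u 3, L 3)) -
        (∏ m, w (L m)) * (T (u 0, L 0) (u 2, L 2) * T (u 1, L 1) (u 3, L 3)) -
        (∏ m, w (L m)) * (T (u 0, L 0) (u 3, L 3) * T (u 1, L 1) (u 2, L 2)) := fun L => by
    rw [PairIsing.ursellFour_def]
    simp only [hT]
    ring
  simp_rw [hU]
  rw [Finset.sum_sub_distrib, Finset.sum_sub_distrib, Finset.sum_sub_distrib, ← h0, h1, h2]
  -- the last pairing: `T (u 0, ·) (u 3, ·) * T (u 1, ·) (u 2, ·)` in `h3` has the factors as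
  -- `T (u 0,L 0) (u 3,L 3) * T (u 1,L 1) (u 2,L 2)`
  rw [h3]

/-- **Sign of the smeared Ursell function**: all terms `(∏ w) U₄^c ≤ 0` (Lebowitz, `w ≥ 0`), so
`|∑_L (∏ w) U₄^c| = ∑_L (∏ w) |U₄^c|`. [folklore] -/
theorem PairIsing.abs_sum_prod_mul_ursellFour (c : V × β → V × β → ℝ)
    (hc : ∀ a b, a ≠ b → 0 ≤ c a b) {w : β → ℝ} (hw : ∀ l, 0 ≤ w l) (u : Fin 4 → V) :
    |∑ L : Fin (2 * 2) → β, (∏ m, w (L m)) * PairIsing.ursellFour c (fun m => (u m, L m))| =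
      ∑ L : Fin (2 * 2) → β, (∏ m, w (L m)) * |PairIsing.ursellFour c (fun m => (u m, L m))| := by
  have hle : ∀ L : Fin (2 * 2) → β, (∏ m, w (L m)) * PairIsing.ursellFour c (fun m => (u m, L m)) ≤ 0 :=
    fun L => mul_nonpos_of_nonneg_of_nonpos (Finset.prod_nonneg fun m _ => hw _)
      (PairIsing.ursellFour_nonpos c hc _)
  rw [abs_of_nonpos (Finset.sum_nonpos fun L _ => hle L), ← Finset.sum_neg_distrib]
  refine Finset.sum_congr rfl fun L _ => ?_
  rw [abs_of_nonpos (PairIsing.ursellFour_nonpos c hc _), mul_neg]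

/-- **Aizenman's Prop. 12.1 for block variables of a pair-interaction Ising model** ("by
linearity", Aizenman–Duminil-Copin 2021, §7, p. 28): for couplings `c ≥ 0` off the diagonal on
`V × β`, weights `w ≥ 0`, block variables `τₓ = ∑_l w_l σ_{(x,l)}`, `n ≥ 2` and `x ∈ V^{2n}`,
`|⟨∏ᵢ τ_{xᵢ}⟩ - 𝒢_n[S^τ](x)| ≤ (3/2) ∑_s |U₄^τ(x_s)| 𝒢_{n-2}[S^τ](x_{sᶜ})`, from the spin-level
statement `PairIsing.wickDeviation_le aizenman_wickDeviation_le_finite_holds` smeared over the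
constituents: the pairing functional and the `2n`-point function are multilinear
(`sum_prod_mul_pairingSum_eq`, `PairIsing.avg_prod_blockVar_eq_sum`), the remainder factorises along
each `4`-subset (`sum_prod_mul_removeFour_mul_restrictFour`), and the smeared `|U₄|` is `|U₄^τ|` by
Lebowitz' sign (`PairIsing.abs_sum_prod_mul_ursellFour`, `PairIsing.block_ursell_eq_sum`).
[cite: AizenmanCMP1982, Prop. 12.1, eq. (12.3) (p. 37)] [cite: AizenmanDuminilCopinAnnals2021, §7 (p. 28)] -/
theorem PairIsing.block_wickDeviation_le (c : V × β → V × β → ℝ) (hc : ∀ a b, a ≠ b → 0 ≤ c a b)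
    {w : β → ℝ} (hw : ∀ l, 0 ≤ w l) {n : ℕ} (hn : 2 ≤ n) (x : Fin (2 * n) → V) :
    |PairIsing.avg c (fun ρ => ∏ i, ∑ l, w l * (spinAt (x i, l) ρ : ℝ)) -
        pairingSum (fun a a' => ∑ l, ∑ l', w l * w l' * PairIsing.avg c (spinPair (a, l) (a', l')))
          n x| ≤
      3 / 2 * wickRemainder
        (fun a a' => ∑ l, ∑ l', w l * w l' * PairIsing.avg c (spinPair (a, l) (a', l')))
        (fun u : Fin 4 → V => PairIsing.avg c (fun ρ => ∏ m, ∑ l, w l * (spinAt (u m, l) ρ : ℝ)) -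
          (∑ l, ∑ l', w l * w l' * PairIsing.avg c (spinPair (u 0, l) (u 1, l'))) *
            (∑ l, ∑ l', w l * w l' * PairIsing.avg c (spinPair (u 2, l) (u 3, l'))) -
          (∑ l, ∑ l', w l * w l' * PairIsing.avg c (spinPair (u 0, l) (u 2, l'))) *
            (∑ l, ∑ l', w l * w l' * PairIsing.avg c (spinPair (u 1, l) (u 3, l'))) -
          (∑ l, ∑ l', w l * w l' * PairIsing.avg c (spinPair (u 0, l) (u 3, l'))) *
            (∑ l, ∑ l', w l * w l' * PairIsing.avg c (spinPair (u 1, l) (u 2, l'))))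
        n x := by
  classical
  set Ss : V × β → V × β → ℝ := fun p q => PairIsing.avg c (spinPair p q) with hSs
  set Sτ : V → V → ℝ := fun a a' => ∑ l, ∑ l', w l * w l' * Ss (a, l) (a', l') with hSτ
  set Us : (Fin 4 → V × β) → ℝ := PairIsing.ursellFour c with hUs
  set Uτ : (Fin 4 → V) → ℝ := fun u => PairIsing.avg c (fun ρ => ∏ m, ∑ l, w l * (spinAt (u m, l) ρ : ℝ)) -
      Sτ (u 0) (u 1) * Sτ (u 2) (u 3) - Sτ (u 0) (u 2) * Sτ (u 1) (u 3) -
      Sτ (u 0) (u 3) * Sτ (u 1) (u 2) with hUτ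
  have hwL : ∀ {k : ℕ} (L : Fin k → β), 0 ≤ ∏ i, w (L i) := fun L => Finset.prod_nonneg fun i _ => hw _
  have habsU : ∀ u : Fin 4 → V,
      |Uτ u| = ∑ L : Fin (2 * 2) → β, (∏ m, w (L m)) * |Us (fun m => (u m, L m))| := fun u => by
    rw [show Uτ u = ∑ L : Fin (2 * 2) → β, (∏ m, w (L m)) * Us (fun m => (u m, L m)) from
      PairIsing.block_ursell_eq_sum c w u]
    exact PairIsing.abs_sum_prod_mul_ursellFour c hc hw u
  -- Step 1: multilinearity of both terms on the left
  rw [PairIsing.avg_prod_blockVar_eq_sum c w x, ← sum_prod_mul_pairingSum_eq Ss w x,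
    ← Finset.sum_sub_distrib]
  -- Step 2: termwise Prop. 12.1 for the constituent spins
  have hterm : ∀ L : Fin (2 * n) → β,
      |(∏ i, w (L i)) * PairIsing.avg c (spinMonomial fun i => (x i, L i)) -
          (∏ i, w (L i)) * pairingSum Ss n (fun i => (x i, L i))| ≤
        (∏ i, w (L i)) * (3 / 2 * wickRemainder Ss Us n (fun i => (x i, L i))) := fun L => by
    rw [← mul_sub, abs_mul, abs_of_nonneg (hwL L)]
    have h12 := PairIsing.wickDeviation_le aizenman_wickDeviation_le_finite_holds c hc hn
      (fun i => (x i, L i))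
    rw [← hUs] at h12
    exact mul_le_mul_of_nonneg_left h12 (hwL L)
  -- Step 3: factorisation of the smeared remainder along each 4-subset
  have hfac : ∀ s : {s : Finset (Fin (2 * n)) // s.card = 4},
      ∑ L : Fin (2 * n) → β, (∏ i, w (L i)) *
          (|Us (restrictFour (fun i => (x i, L i)) s)| *
            pairingSum Ss (n - 2) (removeFour₂ (fun i => (x i, L i)) s)) =
        pairingSum Sτ (n - 2) (removeFour₂ x s) * |Uτ (restrictFour x s)| := by
    intro s
    -- the two factors
    have hA : ∑ q ∈ Fintype.piFinset (fun _ : Fin (2 * n - 4) => (Finset.univ : Finset β)),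
        (∏ j, w (q j)) *
          pairingSum Ss (n - 2) (fun j => (removeFour₂ x s j, (q ∘ Fin.cast (two_mul_sub_two n)) j)) =
        pairingSum Sτ (n - 2) (removeFour₂ x s) := by
      rw [sum_piFinset_prod_mul_comp_cast (two_mul_sub_two n) Finset.univ w
        (fun q' => pairingSum Ss (n - 2) (fun j => (removeFour₂ x s j, q' j))),
        Fintype.piFinset_univ]
      exact sum_prod_mul_pairingSum_eq Ss w (removeFour₂ x s)
    have hB : ∑ v ∈ Fintype.piFinset (fun _ : Fin 4 => (Finset.univ : Finset β)),
        (∏ j, w (v j)) * |Us (fun m => (restrictFour x s m, v m))| = |Uτ (restrictFour x s)| := by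
      rw [Fintype.piFinset_univ, habsU]
    rw [← hA, ← hB, ← sum_prod_mul_removeFour_mul_restrictFour Finset.univ w
      (fun q => pairingSum Ss (n - 2) (fun j => (removeFour₂ x s j, (q ∘ Fin.cast (two_mul_sub_two n)) j)))
      (fun v => |Us (fun m => (restrictFour x s m, v m))|) s, Fintype.piFinset_univ]
    refine Finset.sum_congr rfl fun L _ => ?_
    congr 1
    rw [mul_comm]
    rfl
  -- Step 4: assemble
  calc |∑ L : Fin (2 * n) → β, ((∏ i, w (L i)) * PairIsing.avg c (spinMonomial fun i => (x i, L i)) -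
          (∏ i, w (L i)) * pairingSum Ss n (fun i => (x i, L i)))|
      ≤ ∑ L : Fin (2 * n) → β, |(∏ i, w (L i)) * PairIsing.avg c (spinMonomial fun i => (x i, L i)) -
          (∏ i, w (L i)) * pairingSum Ss n (fun i => (x i, L i))| := Finset.abs_sum_le_sum_abs _ _
    _ ≤ ∑ L : Fin (2 * n) → β, (∏ i, w (L i)) * (3 / 2 * wickRemainder Ss Us n (fun i => (x i, L i))) :=
        Finset.sum_le_sum fun L _ => hterm L
    _ = 3 / 2 * ∑ s : {s : Finset (Fin (2 * n)) // s.card = 4}, ∑ L : Fin (2 * n) → β,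
          (∏ i, w (L i)) * (|Us (restrictFour (fun i => (x i, L i)) s)| *
            pairingSum Ss (n - 2) (removeFour₂ (fun i => (x i, L i)) s)) := by
        simp only [wickRemainder, Finset.mul_sum]
        rw [Finset.sum_comm]
        refine Finset.sum_congr rfl fun L _ => Finset.sum_congr rfl fun s _ => ?_
        ring
    _ = 3 / 2 * ∑ s : {s : Finset (Fin (2 * n)) // s.card = 4},
          pairingSum Sτ (n - 2) (removeFour₂ x s) * |Uτ (restrictFour x s)| := by
        congr 1
        exact Finset.sum_congr rfl fun s _ => hfac s
    _ = 3 / 2 * wickRemainder Sτ Uτ n x := by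
        simp only [wickRemainder]
        congr 1
        exact Finset.sum_congr rfl fun s _ => mul_comm _ _

end Blocks

/-! ### Part 3. The block Ising lattice laws and the lattice `φ⁴` measure on a finite graph -/

section GraphMeasures

variable {V : Type} [Fintype V] [DecidableEq V] (G : SimpleGraph V) [DecidableRel G.Adj] {N : ℕ}

/-- **Aizenman's Prop. 12.1 for the block Ising lattice laws** `latticeFieldMeasure G (isingMagnetizationLaw N K w) J`
(`K ≥ 0`, `w ≥ 0`, `J ≥ 0`): with `S_{2n}`, `S₂`, `U₄` the correlation functions of the field
`φₓ = τₓ` (`nPoint`, `twoPoint`, `connectedFour` of the coordinate observable),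
`|S_{2n}(x) - 𝒢_n[S₂](x)| ≤ (3/2) R_{2n}(x)` for `n ≥ 2` — `PairIsing.block_wickDeviation_le` through the
dictionary `integral_latticeFieldMeasure_isingMagnetizationLaw_eq_avg`. [cite: AizenmanCMP1982, Prop. 12.1, eq. (12.3) (p. 37)] [cite: AizenmanDuminilCopinAnnals2021, §7 (p. 28)] -/
theorem blockIsing_wickDeviation_le {K : Fin N → Fin N → ℝ} {w : Fin N → ℝ} {J : ℝ}
    (hK : ∀ i j, 0 ≤ K i j) (hw : ∀ i, 0 ≤ w i) (hJ : 0 ≤ J) {n : ℕ} (hn : 2 ≤ n)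
    (x : Fin (2 * n) → V) :
    |nPoint (latticeFieldMeasure G (isingMagnetizationLaw N K w : Measure ℝ) J)
          (fun (a : V) (φ : V → ℝ) => φ a) x -
        pairingSum (Literature.Probability.LatticeModels.twoPoint
          (latticeFieldMeasure G (isingMagnetizationLaw N K w : Measure ℝ) J)
          (fun (a : V) (φ : V → ℝ) => φ a)) n x| ≤
      3 / 2 * wickRemainder
        (Literature.Probability.LatticeModels.twoPoint
          (latticeFieldMeasure G (isingMagnetizationLaw N K w : Measure ℝ) J)
          (fun (a : V) (φ : V → ℝ) => φ a))
        (connectedFour (latticeFieldMeasure G (isingMagnetizationLaw N K w : Measure ℝ) J)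
          (fun (a : V) (φ : V → ℝ) => φ a)) n x := by
  classical
  set μ := latticeFieldMeasure G (isingMagnetizationLaw N K w : Measure ℝ) J with hμ
  set c : V × Fin N → V × Fin N → ℝ := fun a b => (if a.1 = b.1 then K a.2 b.2 else (0 : ℝ)) +
    (if G.Adj a.1 b.1 then J / 2 * (w a.2 * w b.2) else 0) with hc_def
  have hc : ∀ a b : V × Fin N, a ≠ b → 0 ≤ c a b := fun a b _ => blockCoupling_nonneg G hK hw hJ a b
  -- the dictionary for `m`-point functions
  have hnP : ∀ {m : ℕ} (y : Fin m → V), nPoint μ (fun (a : V) (φ : V → ℝ) => φ a) y =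
      PairIsing.avg c (fun ρ => ∏ i, ∑ l, w l * (spinAt (y i, l) ρ : ℝ)) := fun y => by
    unfold nPoint
    exact integral_latticeFieldMeasure_isingMagnetizationLaw_eq_avg G K w J (by fun_prop)
  -- … and for the two-point function
  have h2 : ∀ a b : V, Literature.Probability.LatticeModels.twoPoint μ (fun (a : V) (φ : V → ℝ) => φ a) a b =
      ∑ l, ∑ l', w l * w l' * PairIsing.avg c (spinPair (a, l) (b, l')) := fun a b => by
    unfold Literature.Probability.LatticeModels.twoPoint
    rw [integral_latticeFieldMeasure_isingMagnetizationLaw_eq_avg G K w J (by fun_prop)]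
    have hexp : ∀ ρ : SpinConfig (V × Fin N),
        (∑ i, w i * (spinAt (a, i) ρ : ℝ)) * ∑ i, w i * (spinAt (b, i) ρ : ℝ) =
          ∑ l, ∑ l', w l * w l' * spinPair (a, l) (b, l') ρ := fun ρ => by
      rw [Finset.sum_mul_sum]
      refine Finset.sum_congr rfl fun l _ => Finset.sum_congr rfl fun l' _ => ?_
      rw [spinPair]
      ring
    simp_rw [hexp]
    rw [PairIsing.avg_finset_sum]
    refine Finset.sum_congr rfl fun l _ => ?_
    rw [PairIsing.avg_finset_sum]
    exact Finset.sum_congr rfl fun l' _ => PairIsing.avg_const_mul c _ _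
  have hS : Literature.Probability.LatticeModels.twoPoint μ (fun (a : V) (φ : V → ℝ) => φ a) =
      fun a a' => ∑ l, ∑ l', w l * w l' * PairIsing.avg c (spinPair (a, l) (a', l')) :=
    funext fun a => funext fun b => h2 a b
  have hU : connectedFour μ (fun (a : V) (φ : V → ℝ) => φ a) = fun u : Fin 4 → V =>
      PairIsing.avg c (fun ρ => ∏ m, ∑ l, w l * (spinAt (u m, l) ρ : ℝ)) -
        (∑ l, ∑ l', w l * w l' * PairIsing.avg c (spinPair (u 0, l) (u 1, l'))) *
          (∑ l, ∑ l', w l * w l' * PairIsing.avg c (spinPair (u 2, l) (u 3, l'))) -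
        (∑ l, ∑ l', w l * w l' * PairIsing.avg c (spinPair (u 0, l) (u 2, l'))) *
          (∑ l, ∑ l', w l * w l' * PairIsing.avg c (spinPair (u 1, l) (u 3, l'))) -
        (∑ l, ∑ l', w l * w l' * PairIsing.avg c (spinPair (u 0, l) (u 3, l'))) *
          (∑ l, ∑ l', w l * w l' * PairIsing.avg c (spinPair (u 1, l) (u 2, l'))) := by
    funext u
    rw [connectedFour, hnP u, h2, h2, h2, h2, h2, h2]
  rw [hnP x, hS, hU]
  exact PairIsing.block_wickDeviation_le c hc hw hn x

omit [DecidableEq V] in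
/-- **Aizenman's Prop. 12.1 (the Wick sandwich, upper half with the remainder `R_{2n}`) for the
lattice `φ⁴` measure on a finite graph.** For `g > 0`, real `κ`, `J ≥ 0`, `n ≥ 2` and any `2n` sites,
`|S_{2n}(x) - 𝒢_n[S₂](x)| ≤ (3/2) ∑_{4-subsets s} |U₄(x_s)| 𝒢_{n-2}[S₂](x_{sᶜ})` under `phi4Measure G g κ J`
— Aizenman 1982, Prop. 12.1 "in a `φ⁴` field theory described by (9.4)", obtained here as in
Aizenman–Duminil-Copin 2021, §7 (p. 28), from the block Ising approximants
(`blockIsing_wickDeviation_le`, `exists_blockIsing_tendsto_integral_phi4Measure`) by continuity of both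
sides in the finitely many correlation values (`tendsto_pairingSum`, `tendsto_wickRemainder`).
[cite: AizenmanCMP1982, Prop. 12.1, eq. (12.3) (p. 37)] [cite: AizenmanDuminilCopinAnnals2021, §6.3 (6.3) (p. 26) with §7 (p. 28)] -/
theorem phi4_wickDeviation_le {g : ℝ} (hg : 0 < g) (κ : ℝ) {J : ℝ} (hJ : 0 ≤ J) {n : ℕ}
    (hn : 2 ≤ n) (x : Fin (2 * n) → V) :
    |nPoint (phi4Measure G g κ J) (fun (a : V) (φ : V → ℝ) => φ a) x -
        pairingSum (Literature.Probability.LatticeModels.twoPoint (phi4Measure G g κ J)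
          (fun (a : V) (φ : V → ℝ) => φ a)) n x| ≤
      3 / 2 * wickRemainder
        (Literature.Probability.LatticeModels.twoPoint (phi4Measure G g κ J)
          (fun (a : V) (φ : V → ℝ) => φ a))
        (connectedFour (phi4Measure G g κ J) (fun (a : V) (φ : V → ℝ) => φ a)) n x := by
  classical
  obtain ⟨Nk, K, w, hK, hw, hlim⟩ := exists_blockIsing_tendsto_integral_phi4Measure G hg κ J
  set μk : ℕ → Measure (V → ℝ) := fun k =>
    latticeFieldMeasure G (isingMagnetizationLaw (Nk k) (K k) (w k) : Measure ℝ) J with hμk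
  set μ := phi4Measure G g κ J with hμ
  -- even-length correlation functions converge
  have hnP : ∀ {m : ℕ} (y : Fin (2 * m) → V),
      Tendsto (fun k => nPoint (μk k) (fun (a : V) (φ : V → ℝ) => φ a) y) atTop
        (𝓝 (nPoint μ (fun (a : V) (φ : V → ℝ) => φ a) y)) := fun {m} y =>
    hlim (fun φ => ∏ i, φ (y i)) (by fun_prop) _ _ (abs_prod_apply_le m y)
  have h2 : ∀ a b : V, Tendsto (fun k =>
      Literature.Probability.LatticeModels.twoPoint (μk k) (fun (a : V) (φ : V → ℝ) => φ a) a b) atTop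
      (𝓝 (Literature.Probability.LatticeModels.twoPoint μ (fun (a : V) (φ : V → ℝ) => φ a) a b)) :=
    fun a b => hlim (fun φ => φ a * φ b) (by fun_prop) 1 1 (fun φ => by
      have ha := Finset.single_le_sum (fun y _ => sq_nonneg (φ y)) (Finset.mem_univ a)
      have hb := Finset.single_le_sum (fun y _ => sq_nonneg (φ y)) (Finset.mem_univ b)
      rw [abs_mul, one_mul, one_mul]
      nlinarith [abs_nonneg (φ a), abs_nonneg (φ b), sq_abs (φ a), sq_abs (φ b),
        Real.add_one_le_exp (∑ y, φ y ^ 2), sq_nonneg (|φ a| - |φ b|)])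
  have h4 : ∀ u : Fin 4 → V, Tendsto (fun k => connectedFour (μk k) (fun (a : V) (φ : V → ℝ) => φ a) u)
      atTop (𝓝 (connectedFour μ (fun (a : V) (φ : V → ℝ) => φ a) u)) := fun u => by
    unfold connectedFour
    exact (((hnP (m := 2) u).sub ((h2 _ _).mul (h2 _ _))).sub ((h2 _ _).mul (h2 _ _))).sub
      ((h2 _ _).mul (h2 _ _))
  have hl := ((hnP (m := n) x).sub (tendsto_pairingSum h2 n x)).abs
  have hr := (tendsto_wickRemainder h2 h4 n x).const_mul (3 / 2 : ℝ)
  exact le_of_tendsto_of_tendsto' hl hr fun k => blockIsing_wickDeviation_le G (hK k) (hw k) hJ hn x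

end GraphMeasures

/-! ### Part 4. Free-boundary volumes of `ℤᵈ` -/

section Zd

variable (d : ℕ)

/-- Free-boundary correlation functions on `ℤᵈ` at points of `Λ` are correlation functions of the
graph measure on `↥Λ`. [folklore] -/
theorem nPoint_phi4FreeMeasure_eq_of_mem (Λ : Finset (Site d)) (g κ J : ℝ) {m : ℕ}
    (q : Fin m → Site d) (hq : ∀ i, q i ∈ Λ) :
    nPoint (phi4FreeMeasure d Λ g κ J) (fun (z : Site d) (φ : Site d → ℝ) => φ z) q =
      nPoint (phi4Measure (zdGraphIn d Λ) g κ J) (fun (a : Λ) (ψ : Λ → ℝ) => ψ a)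
        (fun i => ⟨q i, hq i⟩) := by
  classical
  unfold nPoint
  rw [integral_phi4FreeMeasure d Λ g κ J
    (Finset.measurable_prod _ fun i _ => measurable_pi_apply (q i))]
  refine integral_congr_ae (Eventually.of_forall fun ψ => ?_)
  exact Finset.prod_congr rfl fun i _ => glueWith_apply_mem _ _ _ (hq i)

/-- **Aizenman's Prop. 12.1 for the free-boundary lattice `φ⁴` measures on `ℤᵈ`.** For `g > 0`,
`J ≥ 0`, a finite volume `Λ`, `n ≥ 2` and points `x₁,…,x_{2n} ∈ Λ`:
`|S^Λ_{2n}(x) - 𝒢_n[S₂^Λ](x)| ≤ (3/2) R^Λ_{2n}(x)` with `S₂^Λ = phi4TwoPointIn d Λ g κ J`,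
`S^Λ_{2n} = nPoint (phi4FreeMeasure d Λ g κ J)`, `U₄^Λ = connectedFour (phi4FreeMeasure d Λ g κ J)`
(`phi4_wickDeviation_le` on the graph `↥Λ`, transported by `glueZero`). [cite: AizenmanCMP1982, Prop. 12.1, eq. (12.3) (p. 37)] [cite: AizenmanDuminilCopinAnnals2021, §6.3 (6.3) (p. 26) with §7 (p. 28)] -/
theorem phi4Free_wickDeviation_le (Λ : Finset (Site d)) {g : ℝ} (hg : 0 < g) (κ : ℝ) {J : ℝ}
    (hJ : 0 ≤ J) {n : ℕ} (hn : 2 ≤ n) (p : Fin (2 * n) → Site d) (hp : ∀ i, p i ∈ Λ) :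
    |nPoint (phi4FreeMeasure d Λ g κ J) (fun (z : Site d) (φ : Site d → ℝ) => φ z) p -
        pairingSum (phi4TwoPointIn d Λ g κ J) n p| ≤
      3 / 2 * wickRemainder (phi4TwoPointIn d Λ g κ J)
        (connectedFour (phi4FreeMeasure d Λ g κ J) (fun (z : Site d) (φ : Site d → ℝ) => φ z)) n p := by
  classical
  set μg := phi4Measure (zdGraphIn d Λ) g κ J with hμg
  set p' : Fin (2 * n) → Λ := fun i => ⟨p i, hp i⟩ with hp'
  have h2 : ∀ {x y : Site d} (hx : x ∈ Λ) (hy : y ∈ Λ), phi4TwoPointIn d Λ g κ J x y =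
      Literature.Probability.LatticeModels.twoPoint μg (fun (a : Λ) (ψ : Λ → ℝ) => ψ a) ⟨x, hx⟩ ⟨y, hy⟩ :=
    fun hx hy => phi4TwoPointIn_eq_of_mem d Λ g κ J hx hy
  have hc4 : ∀ e : Fin 4 → Fin (2 * n),
      connectedFour (phi4FreeMeasure d Λ g κ J) (fun (z : Site d) (φ : Site d → ℝ) => φ z) (p ∘ e) =
        connectedFour μg (fun (a : Λ) (ψ : Λ → ℝ) => ψ a) (p' ∘ e) := fun e => by
    unfold connectedFour
    rw [nPoint_phi4FreeMeasure_eq_of_mem d Λ g κ J (p ∘ e) fun m => hp (e m)]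
    have ht : ∀ i j : Fin 4, Literature.Probability.LatticeModels.twoPoint (phi4FreeMeasure d Λ g κ J)
        (fun (z : Site d) (φ : Site d → ℝ) => φ z) ((p ∘ e) i) ((p ∘ e) j) =
        Literature.Probability.LatticeModels.twoPoint μg (fun (a : Λ) (ψ : Λ → ℝ) => ψ a)
          ((p' ∘ e) i) ((p' ∘ e) j) := fun i j => h2 (hp (e i)) (hp (e j))
    rw [ht, ht, ht, ht, ht, ht]
    rfl
  rw [nPoint_phi4FreeMeasure_eq_of_mem d Λ g κ J p hp,
    pairingSum_congr_of_eq (phi4TwoPointIn d Λ g κ J)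
      (Literature.Probability.LatticeModels.twoPoint μg (fun (a : Λ) (ψ : Λ → ℝ) => ψ a)) n p p'
      (fun i j => h2 (hp i) (hp j)),
    wickRemainder_congr_of_eq (phi4TwoPointIn d Λ g κ J)
      (Literature.Probability.LatticeModels.twoPoint μg (fun (a : Λ) (ψ : Λ → ℝ) => ψ a))
      (connectedFour (phi4FreeMeasure d Λ g κ J) (fun (z : Site d) (φ : Site d → ℝ) => φ z))
      (connectedFour μg (fun (a : Λ) (ψ : Λ → ℝ) => ψ a)) n p p'
      (fun i j => h2 (hp i) (hp j)) hc4]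
  exact phi4_wickDeviation_le (zdGraphIn d Λ) hg κ hJ hn p'

/-- **The same in the box vocabulary of `phi44_triviality`** (`phi4BoxMeasure d R`, `phi4TwoPointBox d R`):
for all `R`, `n ≥ 2` and `x ∈ (box R)^{2n}`, `|S^R_{2n}(x) - 𝒢_n[S₂^R](x)| ≤ (3/2) R^R_{2n}(x)` —
the hypothesis `hW` of `Literature.MathematicalPhysics.QuantumFieldTheory.phi44_triviality_of_wickDeviation`
(`ContinuumLimitsPhi4WickProofs`), now a theorem. [cite: AizenmanCMP1982, Prop. 12.1, eq. (12.3) (p. 37)] -/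
theorem phi4Box_wickDeviation_le {g : ℝ} (hg : 0 < g) (κ : ℝ) {J : ℝ} (hJ : 0 ≤ J) (R : ℕ)
    {n : ℕ} (hn : 2 ≤ n) (p : Fin (2 * n) → Site d) (hp : ∀ i, p i ∈ box d R) :
    |nPoint (phi4BoxMeasure d R g κ J) (fun (z : Site d) (φ : Site d → ℝ) => φ z) p -
        pairingSum (phi4TwoPointBox d R g κ J) n p| ≤
      3 / 2 * wickRemainder (phi4TwoPointBox d R g κ J)
        (connectedFour (phi4BoxMeasure d R g κ J) (fun (z : Site d) (φ : Site d → ℝ) => φ z)) n p :=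
  phi4Free_wickDeviation_le d (box d R) hg κ hJ hn p hp

end Zd

end Literature.MathematicalPhysics.QuantumLattice

end
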